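import Summits.QuantumFields.YangMills.Theorems.ParabolicTrajectoryContinuumLimitOnTrajectoryJCGDefs
import Literature.MathematicalPhysics.QuantumLattice.WilsonCouplingSmoothness

/-!
# Crux `ContinuumLimitOnTrajectory` (stmt-QuantumFields-10522), line `jacobian-collapse-gronwall`: the centred curvature moments are smooth

Helper for the ENGINE stub `stub_jacobianCollapse : JacobianCollapse` of the skeleton
`Cruxes/ContinuumLimitOnTrajectory/Lines/jacobian_collapse_gronwall.lean` (lead seat
`prover-line-stmt-QuantumFields-10522-c1-0`; route `ParabolicTrajectory`): the regularity clause `CollapseOn.smooth_X`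
holds UNCONDITIONALLY for every moment observable
`X = obsFun r φ L (ObsIx.moment m f hf) = fun D β => curvMoment r β L D⁻¹ m f` (`obsFun_moment`):
`(D, β) ↦ curvMoment r β L D⁻¹ m f` is `C²` on `{D > 0} × ℝ` (`contDiffOn_curvMoment`), the companion of
`contDiffOn_timeSmeared` (`CollapseOn.smooth_N`).

Proof.  For `a = D⁻¹ ≠ 0` the canonical renormalisation is `a⁻⁴ · a⁴ = 1`; expanding the product of the `m`
smeared sums (`Finset.prod_univ_sum`) the moment is the finite sum over multi-sites `x : Fin m → box 4 L` of
`(∏ i, f i (a • x i)) · ∫ ∏ i, (P_{x i} − ⟨P⟩_β) dμ_β` (`curvMoment_eq_sum`; `P_y U = P(τ_y U)` the shifted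
action density, bounded and measurable).  The first factor is smooth in `D > 0` (Schwartz functions are smooth);
the second is `C^n` in `β` for every `n` (`contDiff_integral_prod_sub`): expand
`∏_{i ∈ S} (u_i − c) = Σ_{t ⊆ S} (−c)^{#(S∖t)} ∏_{i∈t} u_i` (`Finset.prod_add`), pull the finite sum out of the
(probability) integral, and use that `β ↦ ∫ ∏_{i∈t} u_i dμ_β` and `β ↦ ⟨P⟩_β` are `C^n` by the Literature
theorem `contDiff_integral_wilsonMeasure` (iterated Feynman–Hellmann for bounded measurable observables of a
finite torus; Seiler LNP 159 Ch. 1–2).  Nothing here is cited or assumed: plain Mathlib over the tree's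
definitions.
-/

set_option autoImplicit false

open scoped SchwartzMap ContDiff
open MeasureTheory Filter Topology
open Literature.MathematicalPhysics.QuantumFieldTheory Literature.MathematicalPhysics.QuantumLattice
open Literature.Probability.LatticeModels (box)

noncomputable section

namespace Summit.QuantumFields.YangMills.Cruxes.ContinuumLimitOnTrajectory.JacobianCollapseGronwall

section MomentSmooth

variable {G : Type} [Group G] [TopologicalSpace G] [IsTopologicalGroup G] [CompactSpace G]
  [MeasurableSpace G] [BorelSpace G]

/-- A finite product of uniformly bounded real functions is bounded by the corresponding power of the bound. -/
theorem norm_prod_le_pow {ι X : Type} (t : Finset ι) (u : ι → X → ℝ) {C : ℝ}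
    (hC : ∀ i U, ‖u i U‖ ≤ C) (U : X) : ‖∏ i ∈ t, u i U‖ ≤ C ^ t.card :=
  calc ‖∏ i ∈ t, u i U‖ ≤ ∏ i ∈ t, ‖u i U‖ := Finset.norm_prod_le t fun i => u i U
    _ ≤ ∏ _i ∈ t, C := Finset.prod_le_prod (fun _ _ => norm_nonneg _) fun i _ => hC i U
    _ = C ^ t.card := Finset.prod_const C

/-- Bounded measurable observables of the torus of side `2L+1` are integrable against every Wilson measure
`μ_{β, 2L+1}` (a probability measure, `isProbabilityMeasure_wilsonMeasure`). -/
theorem integrable_wilsonMeasure_of_bounded (r : LatticeRep G) (L : ℕ) (β : ℝ)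
    {F : GaugeConfig 4 (2 * L + 1) G → ℝ} (hF : Measurable F) {C : ℝ} (hC : ∀ U, ‖F U‖ ≤ C) :
    Integrable F (wilsonMeasure (d := 4) (L := 2 * L + 1) r.ρ β) := by
  haveI := isProbabilityMeasure_wilsonMeasure (d := 4) (L := 2 * L + 1) r.ρ r.continuous β
  exact Integrable.of_bound hF.aestronglyMeasurable C (ae_of_all _ hC)

/-- **The plaquette mean is smooth in the coupling**: for every `n`, `β ↦ plaqMean r β L = ⟨P⟩_{β, 2L+1}` is
`C^n` on `ℝ` (Literature `contDiff_integral_wilsonMeasure` for the bounded measurable observable `P ∘ torusLift`). -/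
theorem contDiff_plaqMean (r : LatticeRep G) (n L : ℕ) : ContDiff ℝ n fun β => plaqMean r β L := by
  haveI : SecondCountableTopology G :=
    (r.continuous.isClosedEmbedding r.injective).isEmbedding.secondCountableTopology
  obtain ⟨C, hC⟩ := r.curvature.bounded
  unfold plaqMean
  exact contDiff_integral_wilsonMeasure (d := 4) (L := 2 * L + 1) (ρ := r.ρ) r.continuous n
    (r.curvature.measurable.comp (measurable_torusLift _)).aestronglyMeasurable
    (ae_of_all _ fun U => by rw [Real.norm_eq_abs]; exact hC _)

/-- **The `β`-factor of the moments is smooth**: for uniformly bounded measurable observables `u i` of the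
torus and every finite `S`, `β ↦ ∫ ∏ i ∈ S, (u i U − ⟨P⟩_{β,2L+1}) dμ_{β,2L+1}` is `C^n` on `ℝ` for every `n` —
expand the product (`Finset.prod_add`: `∏ (u_i − c) = Σ_{t ⊆ S} (−c)^{#(S∖t)} ∏_{i∈t} u_i`), pull the finite
sum out of the integral, and apply `contDiff_integral_wilsonMeasure` to each bounded measurable `∏_{i∈t} u_i`
and `contDiff_plaqMean` to the powers of `−⟨P⟩_β`. -/
theorem contDiff_integral_prod_sub (r : LatticeRep G) (n L : ℕ) {ι : Type} (S : Finset ι)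
    (u : ι → GaugeConfig 4 (2 * L + 1) G → ℝ) (hu : ∀ i, Measurable (u i)) {C : ℝ}
    (hC : ∀ i U, ‖u i U‖ ≤ C) :
    ContDiff ℝ n fun β => ∫ U, ∏ i ∈ S, (u i U - plaqMean r β L)
      ∂(wilsonMeasure (d := 4) (L := 2 * L + 1) r.ρ β) := by
  classical
  haveI : SecondCountableTopology G :=
    (r.continuous.isClosedEmbedding r.injective).isEmbedding.secondCountableTopology
  have hexp : ∀ (c : ℝ) (U : GaugeConfig 4 (2 * L + 1) G),
      ∏ i ∈ S, (u i U - c) = ∑ t ∈ S.powerset, (-c) ^ (S \ t).card * ∏ i ∈ t, u i U := by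
    intro c U
    simp_rw [sub_eq_add_neg]
    rw [Finset.prod_add]
    exact Finset.sum_congr rfl fun t _ => by rw [Finset.prod_const, mul_comm]
  have hmeas : ∀ t : Finset ι, Measurable fun U => ∏ i ∈ t, u i U := fun t =>
    Finset.measurable_prod t fun i _ => hu i
  have hbd : ∀ (t : Finset ι) (U : GaugeConfig 4 (2 * L + 1) G), ‖∏ i ∈ t, u i U‖ ≤ C ^ t.card :=
    fun t U => norm_prod_le_pow t u hC U
  have hsmooth : ∀ t : Finset ι, ContDiff ℝ n fun β => ∫ U, ∏ i ∈ t, u i U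
      ∂(wilsonMeasure (d := 4) (L := 2 * L + 1) r.ρ β) := fun t =>
    contDiff_integral_wilsonMeasure (d := 4) (L := 2 * L + 1) (ρ := r.ρ) r.continuous n
      (hmeas t).aestronglyMeasurable (ae_of_all _ (hbd t))
  have hfun : (fun β => ∫ U, ∏ i ∈ S, (u i U - plaqMean r β L)
      ∂(wilsonMeasure (d := 4) (L := 2 * L + 1) r.ρ β)) = fun β =>
      ∑ t ∈ S.powerset, (-plaqMean r β L) ^ (S \ t).card *
        ∫ U, ∏ i ∈ t, u i U ∂(wilsonMeasure (d := 4) (L := 2 * L + 1) r.ρ β) := by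
    funext β
    simp_rw [hexp]
    rw [integral_finsetSum]
    · exact Finset.sum_congr rfl fun t _ => integral_const_mul _ _
    · intro t _
      exact (integrable_wilsonMeasure_of_bounded r L β (hmeas t) (hbd t)).const_mul _
  rw [hfun]
  exact ContDiff.sum fun t _ => (((contDiff_plaqMean r n L).neg).pow _).mul (hsmooth t)

/-- **Closed form of the centred canonical moment at a non-zero spacing**: for `a ≠ 0` (so `a⁻⁴ · a⁴ = 1`),
`curvMoment r β L a m f = Σ_{x : Fin m → box} (∏ i, f i (a • x i)) · ∫ ∏ i, (P_{x i} U − ⟨P⟩_β) dμ_β`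
(`Finset.prod_univ_sum`; then the finite sum of bounded measurable integrands leaves the probability
integral). -/
theorem curvMoment_eq_sum (r : LatticeRep G) (β : ℝ) (L : ℕ) {a : ℝ} (ha : a ≠ 0) (m : ℕ)
    (f : Fin m → 𝓢(EuclideanSpace ℝ (Fin 4), ℝ)) :
    curvMoment r β L a m f = ∑ x ∈ Fintype.piFinset (fun _ : Fin m => box 4 L),
      (∏ i, f i (a • siteToE (x i))) *
        ∫ U, ∏ i, (r.curvature.F (configShift (-(x i)) (torusLift (2 * L + 1) U)) - plaqMean r β L)
          ∂(wilsonMeasure (d := 4) (L := 2 * L + 1) r.ρ β) := by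
  classical
  obtain ⟨C, hC⟩ := r.curvature.bounded
  have hPbd : ∀ (y : Fin 4 → ℤ) (U : GaugeConfig 4 (2 * L + 1) G),
      ‖r.curvature.F (configShift (-y) (torusLift (2 * L + 1) U))‖ ≤ C := fun y U => by
    rw [Real.norm_eq_abs]; exact hC _
  have ha4 : a⁻¹ ^ 4 * a ^ 4 = 1 := by rw [inv_pow, inv_mul_cancel₀ (pow_ne_zero 4 ha)]
  have hprod : ∀ U : GaugeConfig 4 (2 * L + 1) G,
      (∏ i, smearedLatticeField r.curvature.F (box 4 L) a (a⁻¹ ^ 4) (plaqMean r β L) (f i)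
        (torusLift (2 * L + 1) U)) = ∑ x ∈ Fintype.piFinset (fun _ : Fin m => box 4 L),
        (∏ i, f i (a • siteToE (x i))) *
          ∏ i, (r.curvature.F (configShift (-(x i)) (torusLift (2 * L + 1) U)) - plaqMean r β L) := by
    intro U
    simp only [smearedLatticeField, ha4, one_mul]
    rw [Finset.prod_univ_sum (fun _ : Fin m => box 4 L)]
    exact Finset.sum_congr rfl fun x _ => Finset.prod_mul_distrib
  have hint : ∀ x : Fin m → Fin 4 → ℤ, Integrable
      (fun U : GaugeConfig 4 (2 * L + 1) G =>
        ∏ i, (r.curvature.F (configShift (-(x i)) (torusLift (2 * L + 1) U)) - plaqMean r β L))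
      (wilsonMeasure (d := 4) (L := 2 * L + 1) r.ρ β) := fun x =>
    integrable_wilsonMeasure_of_bounded r L β
      (Finset.measurable_prod _ fun i _ =>
        (r.curvature.measurable.comp
          ((configShift (-(x i))).measurable.comp (measurable_torusLift _))).sub measurable_const)
      (norm_prod_le_pow Finset.univ
        (fun i U => r.curvature.F (configShift (-(x i)) (torusLift (2 * L + 1) U)) - plaqMean r β L)
        (C := C + ‖plaqMean r β L‖) fun i U =>
          (norm_sub_le _ _).trans (add_le_add (hPbd (x i) U) le_rfl))
  unfold curvMoment
  simp_rw [hprod]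
  rw [integral_finsetSum]
  · exact Finset.sum_congr rfl fun x _ => integral_const_mul _ _
  · intro x _
    exact (hint x).const_mul _

/-- **`CollapseOn.smooth_X` holds for every centred curvature moment** (registered helper of line
jacobian-collapse-gronwall, for `stub_jacobianCollapse`): for all `r`, `L`, `m`, `f`,
`(D, β) ↦ curvMoment r β L D⁻¹ m f` is `C²` on `{D > 0} × ℝ` — by `curvMoment_eq_sum` (with `a = D⁻¹`) it is
there a finite sum of products of `D ↦ ∏ i, f i (D⁻¹ • x i)` (smooth on `D > 0`: Schwartz functions are smooth)
and `β ↦ ∫ ∏ i, (P_{x i} − ⟨P⟩_β) dμ_β` (`C^∞`, `contDiff_integral_prod_sub`). -/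
theorem contDiffOn_curvMoment :
    ∀ {G : Type} [Group G] [TopologicalSpace G] [IsTopologicalGroup G] [CompactSpace G]
      [MeasurableSpace G] [BorelSpace G] (r : LatticeRep G) (L m : ℕ)
      (f : Fin m → 𝓢(EuclideanSpace ℝ (Fin 4), ℝ)),
      ContDiffOn ℝ 2 (Function.uncurry fun D β => curvMoment r β L D⁻¹ m f)
        (Set.Ioi (0 : ℝ) ×ˢ (Set.univ : Set ℝ)) := by
  intro G _ _ _ _ _ _ r L m f
  obtain ⟨C, hC⟩ := r.curvature.bounded
  have hmeas : ∀ y : Fin 4 → ℤ, Measurable fun U : GaugeConfig 4 (2 * L + 1) G =>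
      r.curvature.F (configShift (-y) (torusLift (2 * L + 1) U)) := fun y =>
    r.curvature.measurable.comp ((configShift (-y)).measurable.comp (measurable_torusLift _))
  have hbd : ∀ (y : Fin 4 → ℤ) (U : GaugeConfig 4 (2 * L + 1) G),
      ‖r.curvature.F (configShift (-y) (torusLift (2 * L + 1) U))‖ ≤ C := fun y U => by
    rw [Real.norm_eq_abs]; exact hC _
  have hD : ∀ x : Fin m → Fin 4 → ℤ,
      ContDiffOn ℝ 2 (fun p : ℝ × ℝ => ∏ i, f i (p.1⁻¹ • siteToE (x i)))
        (Set.Ioi (0 : ℝ) ×ˢ (Set.univ : Set ℝ)) := fun x =>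
    contDiffOn_prod fun i _ => ((f i).smooth 2).comp_contDiffOn
      ((contDiffOn_fst.fun_inv fun p hp => ne_of_gt (Set.mem_prod.1 hp).1).fun_smul contDiffOn_const)
  have hB : ∀ x : Fin m → Fin 4 → ℤ,
      ContDiffOn ℝ 2 (fun p : ℝ × ℝ => ∫ U, ∏ i,
        (r.curvature.F (configShift (-(x i)) (torusLift (2 * L + 1) U)) - plaqMean r p.2 L)
          ∂(wilsonMeasure (d := 4) (L := 2 * L + 1) r.ρ p.2))
        (Set.Ioi (0 : ℝ) ×ˢ (Set.univ : Set ℝ)) := fun x =>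
    ((contDiff_integral_prod_sub r 2 L Finset.univ
      (fun i U => r.curvature.F (configShift (-(x i)) (torusLift (2 * L + 1) U)))
      (fun i => hmeas (x i)) fun i U => hbd (x i) U).comp contDiff_snd).contDiffOn
  refine ContDiffOn.congr (f := fun p : ℝ × ℝ => ∑ x ∈ Fintype.piFinset (fun _ : Fin m => box 4 L),
      (∏ i, f i (p.1⁻¹ • siteToE (x i))) *
        ∫ U, ∏ i, (r.curvature.F (configShift (-(x i)) (torusLift (2 * L + 1) U)) - plaqMean r p.2 L)
          ∂(wilsonMeasure (d := 4) (L := 2 * L + 1) r.ρ p.2)) ?_ ?_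
  · exact ContDiffOn.sum fun x _ => (hD x).mul (hB x)
  · rintro ⟨D, β⟩ hp
    exact curvMoment_eq_sum r β L (inv_ne_zero (ne_of_gt (Set.mem_prod.1 hp).1)) m f

end MomentSmooth

end Summit.QuantumFields.YangMills.Cruxes.ContinuumLimitOnTrajectory.JacobianCollapseGronwall

end
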